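import Summits.ResolutionOfSingularities.ResolutionOfSingularities.Theorems.WeightedInvariantJFlatEssSmoothInForm
import Summits.ResolutionOfSingularities.ResolutionOfSingularities.Theorems.WeightedInvariantContactFiltrationTerminal
import Literature.AlgebraicGeometry.Resolution.RegularLocalOrderValuation
import HarnessLib

/-!
# (c11)≤3 for the flat centre filtration `J₃ᵗ = Iota3.jFlatT`, PART 6b-ii/2 — FACE LEMMAS for the descent of contact levels
# in dimension three (door `HypersurfaceCentreConstruction`, stmt-ResolutionOfSingularities-19897; P3 rung clause (c11)≤3;
# ORDER (o53) PART 6 = GAP 1′, hand res-L1-w43-stub-3)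

Topic: `Summits/ResolutionOfSingularities/ResolutionOfSingularities/Theorems`. Helper for the door item
`HypersurfaceCentreConstruction` (stmt-ResolutionOfSingularities-19897, route `WeightedInvariant`), line `local-engine`
(L W4.3), def-free.  Small lemmas for GAP 1″ (`hcorr` of `JFlatEssSmooth.bMax_map_eq_of_corrections`, p547358) in the
Literature's initial-form vocabulary (`weightedIdealW`, `IsInForm`; PART 6b-ii/1 `…JFlatEssSmoothInForm`):

* §1 the level-`(b+1)` condition inside the weight-`b` filtration: `mem_span_pow_sup_of_level_succ` — `f ∈ contactFiltration g
  (b+1) ((b+1)ν)` ⇒ `f ∈ (g^ν) + contactFiltration g b (bν + 1)`; `contactFiltration_le_pow_maximalIdeal_succ` —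
  `contactFiltration g b (bν + 1) ⊆ 𝔪^{ν+1}`; `isUnit_of_level_face` — the coefficient of `g^ν` is a unit when `f ∉ 𝔪^{ν+1}`.
* §2 in-forms: `IsInForm.pow` (powers), `isInForm_coord_zero` (`in_b(y) = Y` for `c = (y, x₁, x₂)`, `w = (b, 1, 1)`),
  `IsInForm.mem_succ_of_zero` (an element with initial form `0` lies in `F_{n+1}`).
* §3 the correction step: `mem_pow_pred_of_mul_mem_pow` (`y a ∈ 𝔪^b`, `y ∉ 𝔪²` ⇒ `a ∈ 𝔪^{b-1}`, the order is a valuation),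
  **`exists_unit_correction_of_mem_weightedIdealW_succ`** — if `r₁ - φ r ∈ F'^{(b,1,1)}_{b+1}` with `r₁, φ r ∈ 𝔪'^b`, `b ≥ 2`,
  then `(φ y + r₁) - u · (φ y + φ r) ∈ 𝔪'^{b+1}` for a unit `u`.

[OURS · L1 W4.3 · (o53)]  Replaces the role of NO printed item; NOT a statement of the manuscript
[claim: Hironaka2017, status: under-review]. AI work, weaker than expert review.  Pure commutative algebra; no named facts.

## References

* V. Cossart, U. Jannsen, S. Saito, LNM 2270 (2020), Def. 8.2, Lemma 8.3. [CossartJannsenSaito2020]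
* H. Hironaka, *Characteristic polyhedra of singularities*, J. Math. Kyoto Univ. 7 (1967), §3. [Hironaka1967]
-/

noncomputable section

open IsLocalRing MvPolynomial Literature.AlgebraicGeometry.Resolution
open Summit.ResolutionOfSingularities.ResolutionOfSingularities.Cruxes.HypersurfaceCentreConstruction.LocalEngine

set_option linter.dupNamespace false -- mandated namespace of this single-conjunct summit

namespace Summit.ResolutionOfSingularities.ResolutionOfSingularities.Theorems

namespace JFlatEssSmooth

/-! ## §1 The level-`(b+1)` condition read in the weight-`b` filtration -/

section Level

variable {S : Type} [CommRing S] [IsLocalRing S]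

/-- **`F_{g,b+1}((b+1)ν) ⊆ (g^ν) + F_{g,b}(bν + 1)`**: in the weight-`b` filtration a level-`(b+1)` element is a multiple of
`g^ν` up to weight `≥ bν + 1` (the pieces `j < ν` have weight `bj + (b+1)(ν-j) = bν + (ν - j) > bν`; the pieces `j ≥ ν` are
multiples of `g^ν`). [cite: Hironaka1967, §3] -/
theorem mem_span_pow_sup_of_level_succ (g : S) (b ν : ℕ) {f : S}
    (hf : f ∈ contactFiltration g (b + 1) ((b + 1) * ν)) :
    f ∈ Ideal.span {g ^ ν} ⊔ contactFiltration g b (b * ν + 1) := by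
  rw [contactFiltration_def] at hf ⊢
  suffices hle : (⨆ j, Ideal.span {g ^ j} * maximalIdeal S ^ ((b + 1) * ν - (b + 1) * j)) ≤
      Ideal.span {g ^ ν} ⊔ ⨆ j, Ideal.span {g ^ j} * maximalIdeal S ^ (b * ν + 1 - b * j) from hle hf
  refine iSup_le fun j => ?_
  by_cases hj : ν ≤ j
  · -- multiples of `g^ν`
    refine le_sup_of_le_left (Ideal.mul_le_right.trans ?_)
    rw [Ideal.span_singleton_le_iff_mem, Ideal.mem_span_singleton]
    exact pow_dvd_pow g hj
  · -- weight `≥ bν + 1`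
    push Not at hj
    obtain ⟨k, rfl⟩ : ∃ k, ν = j + k := ⟨ν - j, by omega⟩
    have hk : 1 ≤ k := by omega
    refine le_sup_of_le_right (le_trans ?_ (le_iSup _ j))
    refine Ideal.mul_mono_right (Ideal.pow_le_pow_right ?_)
    have h1 : (b + 1) * (j + k) - (b + 1) * j = (b + 1) * k := by rw [mul_add, Nat.add_sub_cancel_left]
    have h2 : b * (j + k) + 1 - b * j = b * k + 1 := by rw [mul_add]; omega
    rw [h1, h2, add_mul, one_mul]
    omega

/-- **`F_{g,b}(bν + 1) ⊆ 𝔪^{ν+1}`** for `b ≥ 1`: a monomial `g^j m`, `m ∈ 𝔪^{bν + 1 - bj}`, has order `≥ j + b(ν - j) + 1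
≥ ν + 1` for `j ≤ ν`, and `≥ j ≥ ν + 1` otherwise. [folklore] -/
theorem contactFiltration_le_pow_maximalIdeal_succ (g : S) (hg : g ∈ maximalIdeal S) {b : ℕ} (hb : 1 ≤ b) (ν : ℕ) :
    contactFiltration g b (b * ν + 1) ≤ maximalIdeal S ^ (ν + 1) := by
  rw [contactFiltration_def]
  refine iSup_le fun j => ?_
  have hgj : Ideal.span {g ^ j} ≤ maximalIdeal S ^ j := by
    rw [Ideal.span_singleton_le_iff_mem]
    exact Ideal.pow_mem_pow hg j
  refine (Ideal.mul_mono_left hgj).trans ?_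
  rw [← pow_add]
  refine Ideal.pow_le_pow_right ?_
  by_cases hj : j ≤ ν
  · obtain ⟨k, rfl⟩ : ∃ k, ν = j + k := ⟨ν - j, by omega⟩
    have : b * (j + k) + 1 - b * j = b * k + 1 := by rw [mul_add]; omega
    rw [this]
    have hbk : k ≤ b * k := by nlinarith
    omega
  · omega

/-- **The coefficient of `g^ν` in a level-`(b+1)` expansion is a unit** (`b ≥ 1`): if `f = a g^ν + h` with
`h ∈ F_{g,b}(bν + 1)` and `f ∉ 𝔪^{ν+1}`, then `a` is a unit. [folklore] -/
theorem isUnit_of_level_face {g : S} (hg : g ∈ maximalIdeal S) {b : ℕ} (hb : 1 ≤ b) {ν : ℕ} {f a h : S}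
    (hf : f = a * g ^ ν + h) (hh : h ∈ contactFiltration g b (b * ν + 1)) (hford : f ∉ maximalIdeal S ^ (ν + 1)) :
    IsUnit a := by
  by_contra ha
  apply hford
  rw [hf]
  refine Ideal.add_mem _ ?_ (contactFiltration_le_pow_maximalIdeal_succ g hg hb ν hh)
  rw [pow_succ']
  exact Ideal.mul_mem_mul ((IsLocalRing.mem_maximalIdeal a).mpr ha) (Ideal.pow_mem_pow hg ν)

end Level

/-! ## §2 In-forms: powers, the coordinate `y`, vanishing -/

section InForms

variable {S : Type} [CommRing S] [IsLocalRing S]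

/-- **Powers of initial forms**: `in_{nk}(f^k) = in_n(f)^k`. [cite: CossartJannsenSaito2020, Lemma 8.3] -/
theorem IsInForm.pow (c : Fin 3 → S) {w : Fin 3 → ℕ} {n : ℕ} {f : S} {P : MvPolynomial (Fin 3) (ResidueField S)}
    (h : IsInForm c w n f P) (k : ℕ) : IsInForm c w (n * k) (f ^ k) (P ^ k) := by
  induction k with
  | zero =>
    refine ⟨1, isWeightedHomogeneous_one _ _, by simp, ?_⟩
    simp
  | succ k ih =>
    have := IsInForm.mul c ih h
    rw [pow_succ, pow_succ, Nat.mul_succ]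
    exact this

/-- **`in_{w 0}(c 0) = X 0`**: the first coordinate is its own initial form in degree `w 0`. [folklore] -/
theorem isInForm_coord_zero (c : Fin 3 → S) (w : Fin 3 → ℕ) : IsInForm c w (w 0) (c 0) (X 0) := by
  refine ⟨X 0, isWeightedHomogeneous_X _ _ _, by simp, ?_⟩
  simp

/-- **An element with initial form `0` in degree `n` lies in `F_{n+1}`** (`(c) = 𝔪`, positive weights). [folklore] -/
theorem IsInForm.mem_succ_of_zero (c : Fin 3 → S) (hgen : Ideal.span (Set.range c) = maximalIdeal S)
    {w : Fin 3 → ℕ} (hw : ∀ i, 0 < w i) {n : ℕ} {f : S} (h : IsInForm c w n f 0) :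
    f ∈ weightedIdealW c w (n + 1) := by
  obtain ⟨F, hF, hF0, hrem⟩ := h
  have hcoeff : ∀ m, F.coeff m ∈ maximalIdeal S := (map_residue_eq_zero_iff F).mp hF0
  have heval := eval_mem_succ_of_coeff_mem c hgen hw hF hcoeff
  have : f = (f - eval c F) + eval c F := by ring
  rw [this]
  exact Ideal.add_mem _ hrem heval

end InForms

/-! ## §3 The correction step -/

section Correction

variable {S : Type} [CommRing S] [IsRegularLocalRing S]

/-- **`y a ∈ 𝔪^b`, `y ∉ 𝔪²` ⇒ `a ∈ 𝔪^{b-1}`** in a regular local ring (the order is a valuation: `ord (y a) = 1 + ord a`).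
[cite: Matsumura1987, Thm. 14.3] -/
theorem mem_pow_pred_of_mul_mem_pow {y a : S} (hy : y ∈ maximalIdeal S) (hy2 : y ∉ maximalIdeal S ^ 2) {b : ℕ}
    (h : y * a ∈ maximalIdeal S ^ b) : a ∈ maximalIdeal S ^ (b - 1) := by
  have hy1 : adicOrder y = 1 :=
    le_antisymm ((adicOrder_le_iff y 1).mpr hy2) ((le_adicOrder_iff y 1).mpr (by rwa [pow_one]))
  have hord : (b : ℕ∞) ≤ adicOrder (y * a) := (le_adicOrder_iff _ b).mpr h
  rw [adicOrder_mul, hy1] at hord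
  refine (le_adicOrder_iff a (b - 1)).mp ?_
  rcases eq_or_ne (adicOrder a) ⊤ with htop | hne
  · rw [htop]; exact le_top
  · obtain ⟨n, hn⟩ := ENat.ne_top_iff_exists.mp hne
    rw [← hn] at hord ⊢
    have h' : b ≤ 1 + n := by exact_mod_cast hord
    exact_mod_cast (show b - 1 ≤ n by omega)

/-- **THE CORRECTION STEP**: `c' = (φ y, φ x₁, φ x₂)` generating `𝔪'`, `b ≥ 2`, `r₁, t ∈ 𝔪'^b` (think `t = φ r`) with
`r₁ - t ∈ F'^{(b,1,1)}_{b+1}`.  Then `(φ y + r₁) - u · (φ y + t) ∈ 𝔪'^{b+1}` for some unit `u`: indeed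
`F'_{b+1} = 𝔪'^{b+1} + (φ y) 𝔪' + (φ y)^2 S'`, so `r₁ - t = m + (φ y) a` with `m ∈ 𝔪'^{b+1}`, and `(φ y) a ∈ 𝔪'^b` forces
`a ∈ 𝔪'^{b-1}`; take `u = 1 + a`. [OURS · L1 W4.3 · (o53) GAP 1″] -/
theorem exists_unit_correction_of_mem_weightedIdealW_succ {y' x₁' x₂' : S}
    (hgen : Ideal.span {y', x₁', x₂'} = maximalIdeal S) (hy2 : y' ∉ maximalIdeal S ^ 2) {b : ℕ} (hb : 2 ≤ b) {r₁ t : S}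
    (hr₁ : r₁ ∈ maximalIdeal S ^ b) (ht : t ∈ maximalIdeal S ^ b)
    (h : r₁ - t ∈ weightedIdealW ![y', x₁', x₂'] ![b, 1, 1] (b + 1)) :
    ∃ u : S, IsUnit u ∧ (y' + r₁) - u * (y' + t) ∈ maximalIdeal S ^ (b + 1) := by
  have hy : y' ∈ maximalIdeal S := hgen ▸ Ideal.subset_span (by simp)
  rw [weightedIdealW_eq_contactFiltration y' x₁' x₂' hgen (by omega : 1 ≤ b), contactFiltration_def] at h
  -- `F'_{b+1} ≤ 𝔪^{b+1} + (y')·𝔪`  (pieces: `j = 0`; `j = 1`; `j ≥ 2` is a multiple of `y'^2 ∈ (y') 𝔪`)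
  have hle : (⨆ j, Ideal.span {y' ^ j} * maximalIdeal S ^ (b + 1 - b * j)) ≤
      maximalIdeal S ^ (b + 1) ⊔ Ideal.span {y'} * maximalIdeal S := by
    refine iSup_le fun j => ?_
    rcases Nat.lt_or_ge j 1 with hj | hj
    · have : j = 0 := by omega
      subst this
      rw [mul_zero, Nat.sub_zero, pow_zero, Ideal.span_singleton_one, Ideal.top_mul]
      exact le_sup_left
    · refine le_sup_of_le_right ?_
      rcases Nat.lt_or_ge j 2 with hj2 | hj2
      · have : j = 1 := by omega
        subst this
        refine Ideal.mul_mono (by rw [pow_one]) (Ideal.pow_le_self ?_)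
        omega
      · -- `y'^j = y' · y'^{j-1}` with `y'^{j-1} ∈ 𝔪`
        refine Ideal.mul_le_right.trans ?_
        rw [Ideal.span_singleton_le_iff_mem]
        have : y' ^ j = y' * y' ^ (j - 1) := by rw [← pow_succ', Nat.sub_add_cancel (by omega)]
        rw [this]
        exact Ideal.mul_mem_mul (Ideal.mem_span_singleton_self y') (Ideal.pow_mem_of_mem _ hy _ (by omega))
  obtain ⟨m, hm, ya, hya, hsum⟩ := Submodule.mem_sup.mp (hle h)
  -- `ya = y' * a`
  obtain ⟨a, -, rfl⟩ := Ideal.mem_span_singleton_mul.mp hya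
  -- `y' a ∈ 𝔪^b`, so `a ∈ 𝔪^{b-1}`
  have hyab : y' * a ∈ maximalIdeal S ^ b := by
    have : y' * a = (r₁ - t) - m := by rw [← hsum]; ring
    rw [this]
    exact Ideal.sub_mem _ (Ideal.sub_mem _ hr₁ ht) (Ideal.pow_le_pow_right (Nat.le_succ b) hm)
  have ha : a ∈ maximalIdeal S ^ (b - 1) := mem_pow_pred_of_mul_mem_pow hy hy2 hyab
  have ham : a ∈ maximalIdeal S := Ideal.pow_le_self (by omega) ha
  refine ⟨1 + a, ?_, ?_⟩
  · have h := IsLocalRing.isUnit_one_sub_self_of_mem_nonunits (-a) (neg_mem ham)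
    rwa [sub_neg_eq_add] at h
  · have : y' + r₁ - (1 + a) * (y' + t) = (r₁ - t - y' * a) - a * t := by ring
    rw [this]
    refine Ideal.sub_mem _ ?_ ?_
    · rw [← hsum]; simpa using hm
    · have : b + 1 ≤ (b - 1) + b := by omega
      exact Ideal.pow_le_pow_right this (by rw [pow_add]; exact Ideal.mul_mem_mul ha ht)

end Correction

end JFlatEssSmooth

end Summit.ResolutionOfSingularities.ResolutionOfSingularities.Theorems

end
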